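import Mathlib.Analysis.SpecialFunctions.Pow.Deriv
import Literature.Analysis.FluidPDE.CompressibleEulerImplosion
import Literature.Analysis.FluidPDE.EulerReynolds
import Literature.MathematicalPhysics.KineticTheory.HardSphereEulerLLN
import Summits.AtomisticToContinuum.HydrodynamicLimit.Theorems.ImplosionDichotomyPolynomialCompressionIdealGasBridge

/-!
# Scaling of isentropic implosions and the mass-normalised smooth ideal-gas implosion

Second helper toward the stub `stub_typeOneImplosion` of the line `log-lipschitz-budget` (crux
`ImplosionDichotomy.PolynomialCompression`, stmt-AtomisticToContinuum-12587), complementing the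
bridge `isHardSphereEulerSolution_zero_of_isentropic`
(`…Theorems.ImplosionDichotomyPolynomialCompressionIdealGasBridge`).

The stub asks for data `ρ₁ 0 = a₀ / ∫ a₀` (unit mass) on the UNIT torus, whereas the vendored
named fact `Literature.Analysis.FluidPDE.CaolaboraEtAl2025_thm12_euler γ` produces an isentropic
solution of arbitrary mass. The two-parameter scaling symmetry of the isentropic Euler system
(Cao-Labora–Gómez-Serrano–Shi–Staffilani, Rem. 1.4) closes this gap without touching space:

* `isIsentropicEulerSolution_rescale` — for `γ = 5/3` and every `μ > 0`, if `(ρ, u)` is a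
  classical isentropic solution on `[0, T)`, then `(t, x) ↦ (μ³ ρ(μt, x), μ u(μt, x))` is a
  classical isentropic solution on `[0, T/μ)` (mass scales by `μ⁴`, momentum by `μ⁵ = (μ³)^{5/3}`);
* `exists_smooth_isentropic_idealGasImplosion_of_thm12` — from the named fact at `γ = 5/3`: smooth
  positive profiles `(a₀, u₀, θ₀)` on `𝕋³` and a classical solution of the FULL ideal-gas system
  `IsHardSphereEulerSolution 0 T₁ ρ₁ u₁ θ₁`, `T₁ > 0`, with data `(a₀/∫a₀, u₀, θ₀)`, isentropic
  (`θ₁ = (3/5) ρ₁^{2/3}`), whose density is unbounded on `[0, T₁)` — i.e. every clause of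
  `stub_typeOneImplosion` except the four RATE clauses (Type-I gradient bounds, polynomial bounds
  on all derivatives, polynomial no-vacuum bound, power-law core growth), which the rate-free
  named fact cannot supply; and, after forgetting smoothness, the route support
  `ImplosionDichotomy.IdealGasImplosion` (stmt-AtomisticToContinuum-12588) conditional on the fact.
-/

noncomputable section

namespace Summit.AtomisticToContinuum.HydrodynamicLimit.Theorems

open Set MeasureTheory Filter
open scoped ContDiff
open Literature.MathematicalPhysics.KineticTheory
open Literature.Analysis.FunctionSpaces Literature.Analysis.FunctionSpaces.Torus
open Literature.Analysis.FluidPDE (IsIsentropicEulerSolution CaolaboraEtAl2025_thm12_euler)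

/-! ## Time dilation on `[0, T)` -/

/-- `t ∈ [0, T/c)` and `c > 0` give `c t ∈ [0, T)`. [folklore] -/
theorem mul_mem_Ico_of_mem_Ico_div {T c t : ℝ} (hc : 0 < c) (ht : t ∈ Ico 0 (T / c)) :
    c * t ∈ Ico 0 T :=
  ⟨mul_nonneg hc.le ht.1, by rw [mul_comm]; exact (lt_div_iff₀ hc).1 ht.2⟩

/-- Joint smoothness on `[0,T) × 𝕋³` is preserved by the time dilation `(t, x) ↦ w (c t) x` to
`[0, T/c) × 𝕋³`, `c > 0`. [folklore] -/
-- adapted from Literature/Analysis/FluidPDE/EulerReynolds.lean (`IsSmoothSpaceTimeOn.comp_mul_time`, `Icc` version)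
theorem isSmoothSpaceTimeOn_comp_mul_Ico {F : Type*} [NormedAddCommGroup F] [NormedSpace ℝ F]
    {T c : ℝ} {w : ℝ → T3 → F} (hw : IsSmoothSpaceTimeOn (Ico 0 T) w) (hc : 0 < c) :
    IsSmoothSpaceTimeOn (Ico 0 (T / c)) (fun t x => w (c * t) x) := by
  have hφ : ContDiff ℝ ∞ (fun z : ℝ × EuclideanSpace ℝ (Fin 3) =>
      ((c * z.1, z.2) : ℝ × EuclideanSpace ℝ (Fin 3))) :=
    (contDiff_const.mul contDiff_fst).prodMk contDiff_snd
  have hmaps : MapsTo (fun z : ℝ × EuclideanSpace ℝ (Fin 3) =>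
      ((c * z.1, z.2) : ℝ × EuclideanSpace ℝ (Fin 3))) (Ico 0 (T / c) ×ˢ univ) (Ico 0 T ×ˢ univ) := by
    rintro ⟨t, y⟩ hz
    exact mk_mem_prod (mul_mem_Ico_of_mem_Ico_div hc (mem_prod.1 hz).1) (mem_univ _)
  exact hw.comp hφ.contDiffOn hmaps

/-- Chain rule for the one-sided time derivative under the time dilation `t ↦ c t` from `[0, T/c)`
to `[0, T)` (`c > 0`): `∂ₜ[w(c ·)](t, x) = c ∂ₜw(ct, x)`. [folklore] -/
theorem timeDerivWithin_comp_mul_Ico {F : Type*} [NormedAddCommGroup F] [NormedSpace ℝ F]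
    {T c : ℝ} {w : ℝ → T3 → F} (hw : IsSmoothSpaceTimeOn (Ico 0 T) w) (hc : 0 < c) {t : ℝ}
    (ht : t ∈ Ico 0 (T / c)) (x : T3) :
    timeDerivWithin (Ico 0 (T / c)) (fun s y => w (c * s) y) t x =
      c • timeDerivWithin (Ico 0 T) w (c * t) x := by
  have hg := hw.hasDerivWithinAt_slice (mul_mem_Ico_of_mem_Ico_div hc ht) x
  have hh : HasDerivWithinAt (fun τ : ℝ => c * τ) c (Ico 0 (T / c)) t := by
    simpa using (hasDerivWithinAt_id t (Ico 0 (T / c))).const_mul c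
  have hmaps : MapsTo (fun τ : ℝ => c * τ) (Ico 0 (T / c)) (Ico 0 T) := fun τ hτ =>
    mul_mem_Ico_of_mem_Ico_div hc hτ
  exact (hg.scomp t hh hmaps).derivWithin (uniqueDiffOn_Ico 0 (T / c) t ht)

/-! ## Scaling covariance of the isentropic system (`γ = 5/3`) -/

variable {T μ : ℝ} {ρ : ℝ → T3 → ℝ} {u : ℝ → T3 → V3}

/-- `(μ³)^{5/3} = μ⁵` for `μ > 0`. [folklore] -/
theorem pow_three_rpow_five_thirds (hμ : 0 < μ) : (μ ^ 3) ^ (5 / 3 : ℝ) = μ ^ 5 := by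
  rw [← Real.rpow_natCast μ 3, ← Real.rpow_mul hμ.le,
    show ((3 : ℕ) : ℝ) * (5 / 3) = (5 : ℕ) by norm_num, Real.rpow_natCast]

/-- Mass equation of the rescaled pair `(μ³ρ(μt), μu(μt))`: it is `μ⁴` times the mass equation of
`(ρ, u)` at `(μt, x)`. [folklore] -/
theorem mass_rescale_of_isentropic (h : IsIsentropicEulerSolution (5 / 3) T ρ u) (hμ : 0 < μ)
    {t : ℝ} (ht : t ∈ Ico 0 (T / μ)) (x : T3) :
    timeDerivWithin (Ico 0 (T / μ)) (fun s y => μ ^ 3 * ρ (μ * s) y) t x +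
      Torus.divergence (fun y => (μ ^ 3 * ρ (μ * t) y) • μ • u (μ * t) y) x = 0 := by
  have hμt := mul_mem_Ico_of_mem_Ico_div hμ ht
  obtain ⟨hρ1, hu1, -⟩ := isContDiff_slices_of_isentropic h hμt
  -- time derivative
  have h1 : timeDerivWithin (Ico 0 (T / μ)) (fun s y => μ ^ 3 * ρ (μ * s) y) t x =
      μ ^ 3 * (μ * timeDerivWithin (Ico 0 T) ρ (μ * t) x) := by
    have hs : IsSmoothSpaceTimeOn (Ico 0 (T / μ)) (fun s y => ρ (μ * s) y) :=
      isSmoothSpaceTimeOn_comp_mul_Ico h.smooth_density hμ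
    have hd := ((hs.hasDerivWithinAt_slice ht x).const_mul (μ ^ 3)).derivWithin
      (uniqueDiffOn_Ico 0 (T / μ) t ht)
    rw [timeDerivWithin_comp_mul_Ico h.smooth_density hμ ht x, smul_eq_mul] at hd
    exact hd
  -- divergence
  have h2 : Torus.divergence (fun y => (μ ^ 3 * ρ (μ * t) y) • μ • u (μ * t) y) x =
      μ ^ 3 * μ * Torus.divergence (fun y => ρ (μ * t) y • u (μ * t) y) x := by
    have hfun : (fun y => (μ ^ 3 * ρ (μ * t) y) • μ • u (μ * t) y) =
        (μ ^ 3 * μ) • fun y => ρ (μ * t) y • u (μ * t) y := by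
      funext y
      simp only [Pi.smul_apply, smul_smul]
      ring_nf
    have hρu1 : IsContDiff 1 (fun y => ρ (μ * t) y • u (μ * t) y) := ContDiff.smul hρ1 hu1
    rw [hfun, Literature.Analysis.FluidPDE.Torus.divergence_const_smul hρu1]
  rw [h1, h2]
  have hm := h.mass (μ * t) hμt x
  linear_combination (μ ^ 3 * μ) * hm

/-- Momentum equation of the rescaled pair `(μ³ρ(μt), μu(μt))`: it is `μ⁵` times the momentum
equation of `(ρ, u)` at `(μt, x)` (`(μ³ρ)^{5/3} = μ⁵ ρ^{5/3}`). [folklore] -/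
theorem momentum_rescale_of_isentropic (h : IsIsentropicEulerSolution (5 / 3) T ρ u) (hμ : 0 < μ)
    {t : ℝ} (ht : t ∈ Ico 0 (T / μ)) (x : T3) :
    (μ ^ 3 * ρ (μ * t) x) • timeDerivWithin (Ico 0 (T / μ)) (fun s y => μ • u (μ * s) y) t x +
      (μ ^ 3 * ρ (μ * t) x) •
        (∑ i, ((μ • u (μ * t) x) i) • partialDeriv i (fun y => μ • u (μ * t) y) x) +
      Torus.gradient (fun y => (μ ^ 3 * ρ (μ * t) y) ^ (5 / 3 : ℝ) / (5 / 3)) x = 0 := by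
  have hμt := mul_mem_Ico_of_mem_Ico_div hμ ht
  obtain ⟨hρ1, hu1, -⟩ := isContDiff_slices_of_isentropic h hμt
  have hpos : ∀ y, 0 < ρ (μ * t) y := h.density_pos _ hμt
  -- (1) time derivative of the rescaled velocity
  have h1 : timeDerivWithin (Ico 0 (T / μ)) (fun s y => μ • u (μ * s) y) t x =
      μ • (μ • timeDerivWithin (Ico 0 T) u (μ * t) x) := by
    have hs : IsSmoothSpaceTimeOn (Ico 0 (T / μ)) (fun s y => u (μ * s) y) :=
      isSmoothSpaceTimeOn_comp_mul_Ico h.smooth_velocity hμ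
    have hd := ((hs.hasDerivWithinAt_slice ht x).const_smul μ).derivWithin
      (uniqueDiffOn_Ico 0 (T / μ) t ht)
    rw [timeDerivWithin_comp_mul_Ico h.smooth_velocity hμ ht x] at hd
    exact hd
  -- (2) spatial derivatives of the rescaled velocity
  have h2 : ∀ i, partialDeriv i (fun y => μ • u (μ * t) y) x = μ • partialDeriv i (u (μ * t)) x :=
    fun i => by
      have := congrFun (partialDeriv_const_smul hu1 μ i) x
      simpa only [Pi.smul_apply, Pi.smul_def] using this
  -- (3) the rescaled pressure `(μ³ρ)^{5/3}/(5/3) = μ⁵ ρ^{5/3}/(5/3)`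
  have hP1 : IsContDiff 1 (fun y => ρ (μ * t) y ^ (5 / 3 : ℝ) / (5 / 3)) :=
    (ContDiff.rpow_const_of_ne hρ1 fun v => (hpos _).ne').div_const _
  have hP : (fun y => (μ ^ 3 * ρ (μ * t) y) ^ (5 / 3 : ℝ) / (5 / 3)) =
      μ ^ 5 • fun y => ρ (μ * t) y ^ (5 / 3 : ℝ) / (5 / 3) := by
    funext y
    simp only [Pi.smul_apply, smul_eq_mul]
    rw [Real.mul_rpow (pow_pos hμ 3).le (hpos y).le, pow_three_rpow_five_thirds hμ]
    ring
  rw [h1, hP, Literature.Analysis.FluidPDE.Torus.gradient_const_smul hP1]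
  simp_rw [h2]
  -- (4) coordinates
  have hmo := h.momentum (μ * t) hμt x
  ext k
  have hk := congrArg (fun v : V3 => v k) hmo
  simp only [PiLp.add_apply, PiLp.smul_apply, PiLp.zero_apply, smul_eq_mul, Fin.sum_univ_three]
    at hk ⊢
  linear_combination μ ^ 5 * hk

/-- **Scaling covariance of the isentropic Euler system** (`γ = 5/3`; Cao-Labora–Gómez-Serrano–
Shi–Staffilani, Rem. 1.4): for `μ > 0`, `(t, x) ↦ (μ³ ρ(μt, x), μ u(μt, x))` is a classical
isentropic solution on `[0, T/μ)` whenever `(ρ, u)` is one on `[0, T)`. [folklore] -/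
theorem isIsentropicEulerSolution_rescale (h : IsIsentropicEulerSolution (5 / 3) T ρ u)
    (hμ : 0 < μ) :
    IsIsentropicEulerSolution (5 / 3) (T / μ) (fun t x => μ ^ 3 * ρ (μ * t) x)
      (fun t x => μ • u (μ * t) x) where
  smooth_density := by
    have hs := (isSmoothSpaceTimeOn_comp_mul_Ico h.smooth_density hμ).const_smul (μ ^ 3)
    simpa only [smul_eq_mul] using hs
  smooth_velocity := (isSmoothSpaceTimeOn_comp_mul_Ico h.smooth_velocity hμ).const_smul μ
  density_pos t ht x := mul_pos (pow_pos hμ 3) (h.density_pos _ (mul_mem_Ico_of_mem_Ico_div hμ ht) x)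
  mass t ht x := mass_rescale_of_isentropic h hμ ht x
  momentum t ht x := momentum_rescale_of_isentropic h hμ ht x

/-! ## The mass-normalised smooth ideal-gas implosion from the named fact -/

/-- **Smooth, isentropic, unit-mass ideal-gas implosion on `𝕋³` from the vendored named fact.**
Assuming `CaolaboraEtAl2025_thm12_euler (5/3)` (Cao-Labora–Gómez-Serrano–Shi–Staffilani, Thm 1.2 +
Rem 1.4–1.5, with the Buckmaster–Cao-Labora–Gómez-Serrano `γ = 5/3` profile): there are smooth
positive profiles `(a₀, u₀, θ₀)` and a classical solution `(ρ₁, u₁, θ₁)` of the full hard-sphere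
Euler system at `σ = 0` (monatomic ideal gas) on `[0, T₁)`, `T₁ > 0`, with data `(a₀/∫a₀, u₀, θ₀)`,
isentropic with constant `K = 3/5`, whose density is unbounded on `[0, T₁)`. Proof: rescale the
isentropic solution of the fact to unit mass (`isIsentropicEulerSolution_rescale` with
`μ³ = (∫ρ(0))⁻¹`), apply the bridge `isHardSphereEulerSolution_zero_of_isentropic`, and take the
time-`0` slices as profiles. These are all clauses of `stub_typeOneImplosion` but the four rate
clauses. [folklore] -/
theorem exists_smooth_isentropic_idealGasImplosion_of_thm12 :
    Literature.Analysis.FluidPDE.CaolaboraEtAl2025_thm12_euler (5 / 3) →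
      ∃ (a₀ θ₀ : T3 → ℝ) (u₀ : T3 → V3), Torus.IsSmooth a₀ ∧ Torus.IsSmooth θ₀ ∧ Torus.IsSmooth u₀ ∧
        (∀ x, 0 < a₀ x) ∧ (∀ x, 0 < θ₀ x) ∧
        ∃ (T₁ K : ℝ) (ρ₁ θ₁ : ℝ → T3 → ℝ) (u₁ : ℝ → T3 → V3), 0 < T₁ ∧ 0 < K ∧
          IsHardSphereEulerSolution 0 T₁ ρ₁ u₁ θ₁ ∧
          (∀ x, ρ₁ 0 x = a₀ x / ∫ y, a₀ y) ∧ u₁ 0 = u₀ ∧ θ₁ 0 = θ₀ ∧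
          (∀ t ∈ Ico 0 T₁, ∀ x, θ₁ t x = K * ρ₁ t x ^ (2 / 3 : ℝ)) ∧
          ∀ M : ℝ, ∃ t ∈ Ico 0 T₁, ∃ x, M ≤ ρ₁ t x := by
  intro hfact
  obtain ⟨T, hT, ρ, u, hsol, hunb⟩ := hfact (by norm_num)
  have h0 : (0 : ℝ) ∈ Ico 0 T := ⟨le_rfl, hT⟩
  -- the mass of the time-`0` slice and the normalising dilation factor
  set m : ℝ := ∫ y, ρ 0 y with hm_def
  have hm : 0 < m :=
    integral_pos_of_continuous_pos (hsol.smooth_density.isSmooth_slice h0).continuous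
      (hsol.density_pos 0 h0)
  set μ : ℝ := m ^ (-(1 / 3) : ℝ) with hμ_def
  have hμ : 0 < μ := Real.rpow_pos_of_pos hm _
  have hμ3 : μ ^ 3 * m = 1 := by
    rw [hμ_def, ← Real.rpow_natCast, ← Real.rpow_mul hm.le,
      show -(1 / 3 : ℝ) * ((3 : ℕ) : ℝ) = -1 by norm_num, Real.rpow_neg_one, inv_mul_cancel₀ hm.ne']
  -- the rescaled isentropic solution and the full ideal-gas solution
  have hres := isIsentropicEulerSolution_rescale hsol hμ
  have hfull := isHardSphereEulerSolution_zero_of_isentropic hres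
  have hT₁ : 0 < T / μ := div_pos hT hμ
  have h0' : (0 : ℝ) ∈ Ico 0 (T / μ) := ⟨le_rfl, hT₁⟩
  refine ⟨fun x => μ ^ 3 * ρ (μ * 0) x, fun x => 3 / 5 * (μ ^ 3 * ρ (μ * 0) x) ^ (2 / 3 : ℝ),
    fun x => μ • u (μ * 0) x, hres.smooth_density.isSmooth_slice h0',
    hfull.smooth_temperature.isSmooth_slice h0', hres.smooth_velocity.isSmooth_slice h0',
    hres.density_pos 0 h0', hfull.temperature_pos 0 h0', T / μ, 3 / 5, _, _, _, hT₁, by norm_num,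
    hfull, fun x => ?_, rfl, rfl, fun t _ x => rfl, fun M => ?_⟩
  · -- unit mass: `∫ μ³ ρ(0) = μ³ m = 1`
    have hint : ∫ y, μ ^ 3 * ρ (μ * 0) y = 1 := by
      rw [integral_const_mul, mul_zero, ← hm_def, hμ3]
    rw [hint, div_one]
  · -- unbounded density
    obtain ⟨t, ht, x, hx⟩ := hunb (M / μ ^ 3)
    refine ⟨t / μ, ⟨div_nonneg ht.1 hμ.le, div_lt_div_of_pos_right ht.2 hμ⟩, x, ?_⟩
    have hμ3pos : 0 < μ ^ 3 := pow_pos hμ 3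
    calc M = μ ^ 3 * (M / μ ^ 3) := by field_simp
      _ ≤ μ ^ 3 * ρ (μ * (t / μ)) x := by
          rw [mul_div_cancel₀ t hμ.ne']
          exact mul_le_mul_of_nonneg_left hx hμ3pos.le

end Summit.AtomisticToContinuum.HydrodynamicLimit.Theorems

end
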